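import Mathlib
import Summits.PneNP.PneNP.Theorems.Nc03AvoidResidualCoreCandStarCover

/-!
# Route Nc03AvoidResidualCore, crux `CandStarReduction` (X₂) — the tangled-surplus solver, III: forcing and the affine read-out

Helper file for `stmt-PneNP-19963` (sequel of `…CandStarCover`; cell pnp-ideate, rung F-N1b). On a genuine
pure-`CAND` instance `J`:

* the patterns the solver outputs (`yS S`: the first-edge indicator `σ` flipped on a flip set `S ∈ kers`)
  separate the two edges of every chosen cherry, so every preimage has ALL forced variables `= 1`
  (`forced_of_eval`, from `…CandCherry.apex_eq_true_of_cherry`);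
* then every covered output reads an AFFINE function of the unforced variables: the vector
  `Wv J y = (y ⊕ β)·𝟙_{TS}` of `y = J.eval x` is the sum of the program's columns `colVec J v` over the
  unforced variables `v` with `x_v = 1` (`Wv_eval`), hence lies in their span (`Wv_eval_mem_span`);
* reading lemmas: the program's test vectors ARE these vectors (`vecL_tvec`), and the span test reads
  membership in the column span (`test_iff`).

Restricted-model (NC⁰₃) range-avoidance rung F-N1b of the PneNP frontier ladder; no bearing on P vs NP.
-/

set_option linter.dupNamespace false -- `Summit.PneNP.PneNP.…`: summit = sub-problem name (D-0017 single-conjunct layout)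

namespace Summit.PneNP.PneNP.Theorems.Nc03CandStar

open Finset
open Literature.Computability.Complexity Nc03Reduction
open Summit.PneNP.PneNP.Theorems.Nc03AvoidResidualCoreCandFewHeadsRungFP (tri)
open Summit.PneNP.PneNP.Theorems.Nc03AvoidResidualCoreCandFewHeadsRung (pset eval_eq)
open Summit.PneNP.PneNP.Theorems.Nc03AvoidResidualCoreCandCherry (apex_eq_true_of_cherry)

variable {N M : ℕ} (J : LocalMap 3 N M)

/-! ## Reading the forcing data -/

/-- `isF` reads membership in `FS`. -/
theorem isF_eq_decide (w : Fin N) : isF (cher (rawOf J)) w.val = decide (w ∈ FS J) := by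
  unfold FS; simp

/-- `clash` is symmetric. -/
theorem clash_comm (q c : ℕ × ℕ × ℕ) : clash q c = clash c q := by
  unfold clash
  rw [Bool.eq_iff_iff]
  simp only [Bool.or_eq_true, decide_eq_true_eq]
  constructor
  · rintro ((((h | h) | h) | h) | h)
    · exact Or.inl (Or.inl (Or.inl (Or.inl h.symm)))
    · exact Or.inl (Or.inl (Or.inl (Or.inr h.symm)))
    · exact Or.inl (Or.inr h.symm)
    · exact Or.inl (Or.inl (Or.inr h.symm))
    · exact Or.inr h.symm
  · rintro ((((h | h) | h) | h) | h)
    · exact Or.inl (Or.inl (Or.inl (Or.inl h.symm)))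
    · exact Or.inl (Or.inl (Or.inl (Or.inr h.symm)))
    · exact Or.inl (Or.inr h.symm)
    · exact Or.inl (Or.inl (Or.inr h.symm))
    · exact Or.inr h.symm

/-- Distinct chosen cherries do not clash. -/
theorem cher_clash_false {q q' : ℕ × ℕ × ℕ} (hq : q ∈ cher (rawOf J)) (hq' : q' ∈ cher (rawOf J))
    (hne : q ≠ q') : clash q q' = false := by
  obtain ⟨i, hi, rfl⟩ := List.getElem_of_mem hq
  obtain ⟨j, hj, rfl⟩ := List.getElem_of_mem hq'
  have hp := List.pairwise_iff_getElem.1 (cher_pairwise J)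
  rcases lt_trichotomy i j with h | h | h
  · exact hp i j hi hj h
  · subst h; exact absurd rfl hne
  · rw [clash_comm]; exact hp j i hj hi h

/-- Chosen cherries with the same apex are equal. -/
theorem cher_eq_of_apex {q q' : ℕ × ℕ × ℕ} (hq : q ∈ cher (rawOf J)) (hq' : q' ∈ cher (rawOf J))
    (h : q.1 = q'.1) : q = q' := by
  by_contra hne
  exact ((clash_eq_false_iff.1 (cher_clash_false J hq hq' hne)).1 h)

/-- The two edges of a chosen cherry are distinct. -/
theorem cher_fst_ne_snd {q : ℕ × ℕ × ℕ} (hq : q ∈ cher (rawOf J)) : q.2.1 ≠ q.2.2 := by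
  obtain ⟨j, j', u, rfl, hlt, -⟩ := cher_spec J hq
  exact Nat.ne_of_lt hlt

/-- **Second edges are not first edges**: `σ` vanishes on the second edge of every chosen cherry. -/
theorem sig_snd (q : ℕ × ℕ × ℕ) (hq : q ∈ cher (rawOf J)) : sig (cher (rawOf J)) q.2.2 = false := by
  rw [Bool.eq_false_iff]
  intro h
  obtain ⟨q', hq', he⟩ := (sig_iff _ _).1 h
  by_cases hqq : q' = q
  · subst hqq; exact cher_fst_ne_snd J hq he
  · exact (clash_eq_false_iff.1 (cher_clash_false J hq' hq hqq)).2.2.1 he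

/-- `σ` is `1` on the first edge of every chosen cherry. -/
theorem sig_fst (q : ℕ × ℕ × ℕ) (hq : q ∈ cher (rawOf J)) : sig (cher (rawOf J)) q.2.1 = true :=
  (sig_iff _ _).2 ⟨q, hq, rfl⟩

/-! ## Flip sets and the output patterns -/

/-- Members of `kers`. -/
theorem mem_kers_iff {ch : List (ℕ × ℕ × ℕ)} {pr : PRaw} {S : List ℕ} :
    S ∈ kers pr ch ↔ S = [] ∨ (∃ o ∈ covL pr ch, o ∉ edgeL ch ∧ S = [o]) ∨ ∃ q ∈ ch, S = [q.2.1, q.2.2] := by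
  unfold kers
  simp only [List.mem_cons, List.mem_append, List.mem_map, List.mem_filter, Bool.not_eq_true',
    decide_eq_false_iff_not]
  constructor
  · rintro (h | ⟨o, ⟨ho, he⟩, rfl⟩ | ⟨q, hq, rfl⟩)
    · exact Or.inl h
    · exact Or.inr (Or.inl ⟨o, ho, he, rfl⟩)
    · exact Or.inr (Or.inr ⟨q, hq, rfl⟩)
  · rintro (h | ⟨o, ho, he, rfl⟩ | ⟨q, hq, rfl⟩)
    · exact Or.inl h
    · exact Or.inr (Or.inl ⟨o, ⟨ho, he⟩, rfl⟩)
    · exact Or.inr (Or.inr ⟨q, hq, rfl⟩)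

/-- **Every flip set is good**: it contains both edges of each chosen cherry or neither. -/
theorem goodFlip_of_mem_kers {S : List ℕ} (hS : S ∈ kers (rawOf J) (cher (rawOf J))) :
    ∀ q ∈ cher (rawOf J), (q.2.1 ∈ S ↔ q.2.2 ∈ S) := by
  intro q hq
  rcases mem_kers_iff.1 hS with rfl | ⟨o, -, he, rfl⟩ | ⟨q', hq', rfl⟩
  · simp
  · rw [List.mem_singleton, List.mem_singleton]
    have h1 : q.2.1 ∈ edgeL (cher (rawOf J)) := (mem_edgeL_iff _ _).2 ⟨q, hq, Or.inl rfl⟩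
    have h2 : q.2.2 ∈ edgeL (cher (rawOf J)) := (mem_edgeL_iff _ _).2 ⟨q, hq, Or.inr rfl⟩
    constructor
    · intro h; rw [h] at h1; exact absurd h1 he
    · intro h; rw [h] at h2; exact absurd h2 he
  · by_cases hqq : q = q'
    · subst hqq; simp
    · have hc := clash_eq_false_iff.1 (cher_clash_false J hq hq' hqq)
      simp only [List.mem_cons, List.not_mem_nil, or_false]
      constructor
      · rintro (h | h)
        · exact absurd h hc.2.1
        · exact absurd h hc.2.2.1
      · rintro (h | h)
        · exact absurd h hc.2.2.2.1
        · exact absurd h hc.2.2.2.2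

/-- The chosen flip set is a flip set. -/
theorem pick_mem_kers (pr : PRaw) (ch : List (ℕ × ℕ × ℕ)) : pick pr ch ∈ kers pr ch := by
  unfold pick
  cases h : (kers pr ch).find? (fun S => !inSpan pr.2.1 (cols pr ch) (tvec pr ch S)) with
  | none => rw [Option.getD_none]; exact List.mem_cons_self
  | some S => rw [Option.getD_some]; exact List.mem_of_find?_eq_some h

/-- The pattern of a flip set: `σ ⊕ 𝟙_S`. -/
def yS (S : List ℕ) (o : Fin M) : Bool := sig (cher (rawOf J)) o.val ^^ decide (o.val ∈ S)

/-- **Reading the main answer**: it is the pattern of the chosen flip set. -/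
theorem mainOut_read : (fun o : Fin M => (mainOut (rawOf J)).getD o.val false) =
    yS J (pick (rawOf J) (cher (rawOf J))) := by
  funext o
  unfold mainOut mainOutW yS
  rw [rawOf_M, List.getD_eq_getElem?_getD, List.getElem?_map, List.getElem?_range o.isLt]
  rfl

/-- **Forcing.** If the pattern of a good flip set is attained by `x`, every forced variable is `1` in `x`. -/
theorem forced_of_eval (hI : J.IsPure candPred) {S : List ℕ}
    (hS : ∀ q ∈ cher (rawOf J), (q.2.1 ∈ S ↔ q.2.2 ∈ S)) {x : Fin N → Bool}
    (hx : J.eval x = yS J S) : ∀ u ∈ FS J, x u = true := by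
  intro u hu
  obtain ⟨q, hq, hqu⟩ := (mem_FS_iff J).1 hu
  obtain ⟨j, j', u', rfl, -, hh, r, r', hr, hr', hjr, hj'r⟩ := cher_spec J hq
  have huu : u' = u := Fin.ext hqu
  subst huu
  rw [← hjr]
  refine apex_eq_true_of_cherry hI hx hh hr hr' (hjr.trans hj'r.symm) ?_
  unfold yS
  rw [sig_fst J _ hq, sig_snd J _ hq]
  have hiff := hS _ hq
  simp only at hiff
  by_cases h1 : j.val ∈ S
  · have h2 : j'.val ∈ S := hiff.1 h1
    simp [h1, h2]
  · have h2 : j'.val ∉ S := fun h => h1 (hiff.2 h)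
    simp [h1, h2]

/-! ## The affine read-out -/

/-- The vector `(y ⊕ β)·𝟙_{TS}` of a pattern `y`. -/
def Wv (y : Fin M → Bool) : Vec M := fun o =>
  if o ∈ TS J ∧ (y o ^^ bet (rawOf J).2.2 (cher (rawOf J)) o.val) = true then 1 else 0

/-- The column of a variable, read off the program. -/
def colVec (v : Fin N) : Vec M := vecL M (colL (rawOf J) (cher (rawOf J)) v.val)

/-- Reading `bet`. -/
theorem bet_read (o : Fin M) : bet (rawOf J).2.2 (cher (rawOf J)) o.val =
    ((decide (J.vars o 1 ∈ FS J) && decide (J.vars o 2 ∈ FS J)) ^^ decide (J.vars o 0 ∈ FS J)) := by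
  unfold bet
  rw [tri_rawOf]
  simp only [tripOf, isF_eq_decide]

/-- Reading `colB` on an unforced variable of a pure instance: the incidence of `v` in output `o`. -/
theorem colB_read {v : Fin N} (hv : v ∉ FS J) {o : Fin M} (ho : o ∈ TS J) :
    colB (rawOf J).2.2 (cher (rawOf J)) v.val o.val = true ↔
      (J.vars o 0 = v ∨ J.vars o 1 = v ∨ J.vars o 2 = v) := by
  unfold colB
  rw [tri_rawOf]
  simp only [tripOf, isF_eq_decide, Bool.or_eq_true, Bool.and_eq_true, decide_eq_true_eq, Fin.val_inj]
  rw [mem_TS_iff] at ho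
  constructor
  · rintro ((h | ⟨h, -⟩) | ⟨h, -⟩)
    · exact Or.inl h
    · exact Or.inr (Or.inl h)
    · exact Or.inr (Or.inr h)
  · rintro (h | h | h)
    · exact Or.inl (Or.inl h)
    · refine Or.inl (Or.inr ⟨h, ?_⟩)
      rcases ho with ho | ho
      · exact absurd (h ▸ ho) hv
      · exact ho
    · refine Or.inr ⟨h, ?_⟩
      rcases ho with ho | ho
      · exact ho
      · exact absurd (h ▸ ho) hv

/-- `covL` of a genuine instance is duplicate-free. -/
theorem nodup_covL : (covL (rawOf J) (cher (rawOf J))).Nodup := by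
  unfold covL; exact (List.nodup_range).filter _

/-- Membership of a genuine index in `covL`. -/
theorem mem_covL_iff_TS (o : Fin M) : o.val ∈ covL (rawOf J) (cher (rawOf J)) ↔ o ∈ TS J := by
  unfold TS covL
  rw [List.mem_filter, List.mem_range, rawOf_M, Finset.mem_filter]
  simp [o.isLt]

/-- Members of `covL` are genuine indices. -/
theorem lt_of_mem_covL {o : ℕ} (ho : o ∈ covL (rawOf J) (cher (rawOf J))) : o < M := by
  unfold covL at ho
  rw [List.mem_filter, List.mem_range, rawOf_M] at ho
  exact ho.1

/-- The vector of a duplicate-free index list is its indicator. -/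
theorem vecL_of_nodup {l : List ℕ} (hl : l.Nodup) (o : Fin M) : vecL M l o = if o.val ∈ l then 1 else 0 := by
  unfold vecL
  by_cases h : o.val ∈ l
  · rw [if_pos h, List.count_eq_one_of_mem hl h, Nat.cast_one]
  · rw [if_neg h, List.count_eq_zero_of_not_mem h, Nat.cast_zero]

/-- **Reading a column** at an unforced variable: `𝟙_{TS}·(e_{head} + e_{data₁} + e_{data₂})(v)`. -/
theorem colVec_apply (hI : J.IsPure candPred) {v : Fin N} (hv : v ∉ FS J) (o : Fin M) :
    colVec J v o = if o ∈ TS J then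
      (if J.vars o 0 = v then 1 else 0) + (if J.vars o 1 = v then 1 else 0) + (if J.vars o 2 = v then 1 else 0)
      else 0 := by
  unfold colVec colL
  rw [vecL_of_nodup ((nodup_covL J).filter _)]
  simp only [List.mem_filter, mem_covL_iff_TS]
  by_cases ho : o ∈ TS J
  · rw [if_pos ho]
    have h01 : J.vars o 0 ≠ J.vars o 1 := fun h => absurd (hI.2 o h) (by decide)
    have h02 : J.vars o 0 ≠ J.vars o 2 := fun h => absurd (hI.2 o h) (by decide)
    have h12 : J.vars o 1 ≠ J.vars o 2 := fun h => absurd (hI.2 o h) (by decide)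
    by_cases hc : colB (rawOf J).2.2 (cher (rawOf J)) v.val o.val = true
    · rw [if_pos ⟨ho, hc⟩]
      rcases (colB_read J hv ho).1 hc with h | h | h
      · rw [if_pos h, if_neg (fun e => h01 (h.trans e.symm)), if_neg (fun e => h02 (h.trans e.symm))]; ring
      · rw [if_neg (fun e => h01 (e.trans h.symm)), if_pos h, if_neg (fun e => h12 (h.trans e.symm))]; ring
      · rw [if_neg (fun e => h02 (e.trans h.symm)), if_neg (fun e => h12 (e.trans h.symm)), if_pos h]; ring
    · rw [if_neg (fun h => hc h.2)]
      have hn := fun h => hc ((colB_read J hv ho).2 h)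
      rw [if_neg (fun e => hn (Or.inl e)), if_neg (fun e => hn (Or.inr (Or.inl e))),
        if_neg (fun e => hn (Or.inr (Or.inr e)))]
      ring
  · rw [if_neg ho, if_neg (fun h => ho h.1)]

/-- The identity behind the read-out (in `𝔽₂`): under forcing — a forced data variable is `1`, and one
data variable is forced — `(H ⊕ A·B) ⊕ ([a f]·[b f] ⊕ [h f]) = (H ⊕ [h f]) + (A ⊕ [a f]) + (B ⊕ [b f])`. -/
theorem readout_core (H A B dh da db : Bool) (ha : da = true → A = true) (hb : db = true → B = true)
    (hab : da = true ∨ db = true) :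
    (if ((H ^^ (A && B)) ^^ ((da && db) ^^ dh)) = true then (1 : ZMod 2) else 0) =
      (if (H ^^ dh) = true then (1 : ZMod 2) else 0) + (if (A ^^ da) = true then (1 : ZMod 2) else 0) +
        (if (B ^^ db) = true then (1 : ZMod 2) else 0) := by
  revert H A B dh da db ha hb hab; decide

/-- Sum of an indicator of one point over a finset. -/
theorem sum_ite_eq_mem (U : Finset (Fin N)) (w : Fin N) :
    (∑ v ∈ U, (if w = v then (1 : ZMod 2) else 0)) = if w ∈ U then 1 else 0 :=
  Finset.sum_ite_eq U w (fun _ => (1 : ZMod 2))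

/-- **The affine read-out.** If all forced variables are `1` in `x`, then
`Wv J (J.eval x) = Σ_{v ∉ FS, x_v = 1} colVec J v`. -/
theorem Wv_eval (hI : J.IsPure candPred) {x : Fin N → Bool} (hx : ∀ u ∈ FS J, x u = true) :
    Wv J (J.eval x) = ∑ v ∈ univ.filter (fun v => v ∉ FS J ∧ x v = true), colVec J v := by
  set U := univ.filter (fun v => v ∉ FS J ∧ x v = true) with hU
  have hmemU : ∀ w : Fin N, (w ∈ U) ↔ (x w ^^ decide (w ∈ FS J)) = true := by
    intro w
    rw [hU, Finset.mem_filter]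
    by_cases hw : w ∈ FS J
    · have := hx w hw; simp [hw, this]
    · simp [hw]
  funext o
  rw [Finset.sum_apply]
  have hcol : ∀ v ∈ U, colVec J v o = if o ∈ TS J then
      (if J.vars o 0 = v then 1 else 0) + (if J.vars o 1 = v then 1 else 0) + (if J.vars o 2 = v then 1 else 0)
      else 0 := fun v hv => colVec_apply J hI (Finset.mem_filter.1 hv).2.1 o
  rw [Finset.sum_congr rfl hcol]
  unfold Wv
  by_cases ho : o ∈ TS J
  · simp only [ho, true_and, if_true]
    rw [Finset.sum_add_distrib, Finset.sum_add_distrib, sum_ite_eq_mem, sum_ite_eq_mem, sum_ite_eq_mem]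
    have e0 : (if J.vars o 0 ∈ U then (1 : ZMod 2) else 0) =
        if (x (J.vars o 0) ^^ decide (J.vars o 0 ∈ FS J)) = true then 1 else 0 := if_congr (hmemU _) rfl rfl
    have e1 : (if J.vars o 1 ∈ U then (1 : ZMod 2) else 0) =
        if (x (J.vars o 1) ^^ decide (J.vars o 1 ∈ FS J)) = true then 1 else 0 := if_congr (hmemU _) rfl rfl
    have e2 : (if J.vars o 2 ∈ U then (1 : ZMod 2) else 0) =
        if (x (J.vars o 2) ^^ decide (J.vars o 2 ∈ FS J)) = true then 1 else 0 := if_congr (hmemU _) rfl rfl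
    rw [e0, e1, e2, eval_eq hI, bet_read]
    have hTS := (mem_TS_iff J).1 ho
    exact readout_core _ _ _ _ _ _ (fun h => hx _ (of_decide_eq_true h)) (fun h => hx _ (of_decide_eq_true h))
      (by rcases hTS with h | h <;> simp [h])
  · simp only [ho, false_and, if_false]
    rw [Finset.sum_const_zero]

/-- **The affine read-out, span form**: `Wv J (J.eval x)` lies in the span of the unforced columns. -/
theorem Wv_eval_mem_span (hI : J.IsPure candPred) {x : Fin N → Bool} (hx : ∀ u ∈ FS J, x u = true) :
    Wv J (J.eval x) ∈ Submodule.span (ZMod 2) (colVec J '' {v | v ∉ FS J}) := by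
  rw [Wv_eval J hI hx]
  refine Submodule.sum_mem _ fun v hv => Submodule.subset_span ⟨v, ?_, rfl⟩
  exact (Finset.mem_filter.1 hv).2.1

/-! ## Reading the span test -/

/-- The test vector of a flip set is the vector of its pattern. -/
theorem vecL_tvec (S : List ℕ) : vecL M (tvec (rawOf J) (cher (rawOf J)) S) = Wv J (yS J S) := by
  funext o
  unfold tvec Wv yS
  rw [vecL_of_nodup ((nodup_covL J).filter _)]
  simp only [List.mem_filter, mem_covL_iff_TS]

/-- The vectors of the program's columns are the columns of the unforced variables. -/
theorem vecL_image_cols : vecL M '' {r | r ∈ cols (rawOf J) (cher (rawOf J))} = colVec J '' {v | v ∉ FS J} := by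
  ext w
  unfold cols colVec
  simp only [Set.mem_image, Set.mem_setOf_eq, List.mem_map, List.mem_filter, List.mem_range, rawOf_N,
    Bool.not_eq_true']
  constructor
  · rintro ⟨r, ⟨v, ⟨hv, hF⟩, rfl⟩, rfl⟩
    refine ⟨⟨v, hv⟩, ?_, rfl⟩
    have := isF_eq_decide J ⟨v, hv⟩
    simp only at this
    rw [this] at hF
    simpa using hF
  · rintro ⟨v, hv, rfl⟩
    refine ⟨colL (rawOf J) (cher (rawOf J)) v.val, ⟨v.val, ⟨v.isLt, ?_⟩, rfl⟩, rfl⟩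
    rw [isF_eq_decide]
    simpa using hv

/-- **Reading the span test**: it holds iff the vector of the pattern lies in the span of the unforced
columns. -/
theorem test_iff (S : List ℕ) :
    inSpan M (cols (rawOf J) (cher (rawOf J))) (tvec (rawOf J) (cher (rawOf J)) S) = true ↔
      Wv J (yS J S) ∈ Submodule.span (ZMod 2) (colVec J '' {v | v ∉ FS J}) := by
  rw [inSpan_iff, vecL_tvec, vecL_image_cols]

end Summit.PneNP.PneNP.Theorems.Nc03CandStar
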